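import Literature.MathematicalPhysics.QuantumFieldTheory.Balaban1983to89.B15Prop1MinimiserTowerAxialGauge

/-!
# `Balaban1983to89.B15Prop1GaugeLetterGammaZeroPin` — [Balaban1988Convergent] = «[III]», (2.2) p. 255 («Γ₀ = Ω₁ᶜ»), (2.11)–(2.13) pp. 256–257;
# [Balaban1985Variational] = «[15]», (4) p. 278, (16)–(18) p. 280; [Balaban1989LargeFieldI] = «[IV]», (1.74) p. 192, p. 193, Prop. 1 p. 194:
# THE GAUGE LETTER (σ) OF THE N12∕s1 ENDPOINT READ ON `Γ₀` — what a residually gauged minimiser IS on the bonds meeting `Ω₁(Z)ᶜ`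
# (the raw datum, verbatim), the LOCATED necessary condition this puts on the letter's `inputs 𝐁_k(Z)` conjunct, and the
# LOCALISED letter the tower-axial gauge does produce, with its tolerances LINEAR in the guard

statement-level skeleton of published theorems with citation tags; proofs where landed; nothing here is a claim about the Yang–Mills mass gap

WHY (cell `pub-ymgap`, HUMAN RULINGS D-0062 ∕ D-0149 ∕ D-0154, width seat `pub-ymgap-dag-n12-w6` g2; node N12 = [B15]; count-neutral helper).  The
Proposition-1 endpoint of record (`B15Prop1EndpointFromLetterFamilies`, its Summits-side chart-constants edition, and the 12Q knit) displays per instance a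
GAUGE LETTER (σ): for every guarded base field `V_k` whose extended datum `Ṽ = ext V_k` is `ρn`-near `1` on a region box, and every (2.12) minimiser `U₀` of
`𝐁_k(Z)` with data `M˙(Q_k^{s*}Ṽ)`, a fine gauge transformation `σ` with the root letter `hu` ([15] (4)) such that `U₀^σ` is near `1` (C1) on the four bonds of
every plaquette touching `Ω₁(Z)` and (Cin) on EVERY bond of `inputs 𝐁_k(Z)`.  This file records three kernel facts about that letter.
(A) [III] (2.2): `Γ₀ = Ω₁ᶜ` is the scale-`0` member of `𝐁_k(Z)`, so `bondsOf Γ₀ ⊆ inputs 𝐁_k(Z)` — EVERY fine bond meeting `Ω₁(Z)ᶜ`, however far from `Z`, is an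
input bond; and the root letter pins `σ = 1` at both ends of such a bond, where the constraint `M⁰ = id` pins `U₀` to the datum: `U₀^σ(b) = U₀(b) = (Q_k^{s*}Ṽ)(b)`,
which on a block-crossing bond is the shadow value `Ṽ⟨B^k b₋, μ(b)⟩`, and — for the p. 193 extension `Ṽ = ext_Λ V_k` and a shadow off `Λ^{(k)}` — the RAW base field
`V_k⟨B^k b₋, μ(b)⟩` (§1–§2).  (B) Hence the LOCATED necessary condition (§3): the (σ) conclusion at `(V_k, U₀)` forces `‖V_k(c) − 1‖ ≤ δin` at every raw `k`-bond `c` off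
`Λ^{(k)}` that is the shadow of a block-crossing bond meeting `Ω₁(Z)ᶜ` — a condition on the base field OUTSIDE the normalised region (outside `Z` whenever `Z ≠ T`), about
which the guard `|V_k(∂p) − 1| < eR on (Z ∩ Λᶜ)^{(k)}` says nothing; so the letter with the GLOBAL `inputs` conjunct is suppliable only at base fields already
`δin`-near `1` off the region box (print: [IV] p. 192 «It is defined in each component of Z separately» — the far datum never enters Prop. 1; [LF-II] p. 357's
`U₀ = exp iξA₀` is a statement on the domain of the analysis, not on `T_ξ`).  (C) What the tower-axial gauge `σ(x) = 𝒰_{U₀}(path x)` of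
`B15Prop1MinimiserTowerAxialGauge` DOES give (§4): near-flatness of `U₀^σ` on any bond set `N` whose `Γ₀`-corridor shadows lie in the normalised region —
the pinned half there, plus the DISPLAYED interior letter [15] (16)–(18) on the bonds inside `Ω₁(Z)` — i.e. the letter with `Cin` LOCALISED to
`inputs 𝐁_k(Z) ∩ N` and C1 verbatim (its bonds lie in `N` by a geometry letter), with ONE tolerance `max ρn Θ`; and (§5) since the datum tolerance `ρn` and
the interior bound `Θ` are linear in the guard `eR` (the normaliser's wander bound; Stokes bounds on `eR`-small plaquettes), the tolerances are LINEAR MODULI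
`(Cρ + CΘ)·eR`, and any target tolerance `δT ≥ (Cρ + CΘ)·eR` is met (the knit chooses `eR` last).

CONTENTS (theorems only; no `def`, no `instance`, no `sorry`).
* §1 `gaugeAct_apply_eq_qsstarGIter0_of_rootLetter` (`U₀^σ = Q_k^{s*}Ṽ` on the bonds meeting `Ω₁ᶜ`, for ANY `σ` with the scale-`0` root letter),
  ★ `gaugeAct_apply_eq_shadow_of_rootLetter` (`= Ṽ⟨B^k b₋, μ(b)⟩` on a block-crossing one), `mem_inputs_of_not_mem` (`bondsOf Γ₀ ⊆ inputs 𝐁_k(Z)`).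
* §2 ★ `gaugeAct_apply_eq_base_of_rootLetter_of_mem_outBonds` — with `Ṽ = ext_Λ g V_k` ([IV] p. 193) and the shadow off `Λ^{(k)}`: `U₀^σ(b) = V_k⟨B^k b₋, μ(b)⟩`, the RAW base field.
* §3 ★★ `norm_base_sub_one_le_of_gaugeLetter` — THE LOCATED NECESSARY CONDITION on the (σ) text of record (hypothesis = its conclusion `∃ σ, hu ∧ C1 ∧ Cin` verbatim):
  `‖V_k(c) − 1‖ ≤ δin` at every far crossing shadow `c`; ★★ `norm_base_sub_one_le_of_gaugeLetterFamily` — the same read off the endpoint's family binder `hσ` at one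
  guarded, box-normalised base field admitting a minimiser ([15] Thm 1, displayed).
* §4 ★★ `dist1_gaugeAct_holAtGauge_le_of_mem_nbhd` (generic junction: pinned half on `N`'s `Γ₀`-bonds + interior letter ⟹ `≤ max ρ Θ` on `N`),
  ★★★ `exists_gaugeLetterLoc_atRecord` — THE LOCALISED (σ) AT THE ENDPOINT'S OBJECTS: `∃ σ, hu ∧ C1(max ρn Θ) ∧ Cin on inputs ∩ N (max ρn Θ)`.
* §5 ★★★ `exists_gaugeLetterLoc_linear_atRecord` (tolerances `(Cρ + CΘ)·eR` from `ρn ≤ Cρ·eR`, `Θ ≤ CΘ·eR`), ★★ `exists_gaugeLetterLoc_of_target_atRecord`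
  (any target `δT` with `(Cρ + CΘ)·eR ≤ δT`), `…_of_target_atRecord_box` (the same at the endpoint's region box `𝒞 := boxBonds LO HI`).
  §4–§5 are stated for a general normalised region `𝒞` of `k`-bonds (the endpoint's `boxBonds LO HI`, or dag-n12-c's general regions).

HONEST FRAMING: kernel bookkeeping of [III] (2.2)∕(2.11)∕(2.16) around landed theorems; the interior estimate [15] (16)–(18) (`hL`), the forest (F1)(F2), the
minimiser and the geometry of `N` are HYPOTHESES; nothing of Bałaban's is asserted; count-neutral; N12 NOT discharged; finite 𝕋⁴ at fixed ε; nothing continuum ∕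
OS ∕ mass-gap ∕ Clay.
-/

noncomputable section

open Set
open scoped Matrix.Norms.L2Operator

namespace Literature.MathematicalPhysics.QuantumFieldTheory.Balaban1983to89.B15Prop1GaugeLetterGammaZeroPin

open T4Continuum B15DeterminingSets GaugeField
open T4CubeChartGnomonic (SU2)
open B16Sect1Backgrounds (toMS)
open B14.Eq213DetSet (Bj maxDomT Bj_zero Bj_of_gt)
open B14.Eq216Concrete (inputs mem_inputs feeds_zero qsstarGIter0_eq)
open B14.Eq22Determines (blockIter)
open T4AxialGaugeSmallField (boxBonds)
open B15Extension193 (extend outBonds extend_eq_of_mem_outBonds)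
open B15Prop1MinimiserTowerAxialGauge (toMS_holAtGauge_eq_one dist1_gaugeAct_holAtGauge_le_of_shadow)
open Literature.MathematicalPhysics.QuantumFieldTheory.BalabanImbrieJaffe1984to88.BIJ85Eq453GaugeField (qsstarGIter0)

variable {P : Params}

/-! ## §1  On the bonds meeting `Ω₁(Z)ᶜ` a residually gauged minimiser IS the datum -/

section GammaZero

variable {G : Type*} [GaugeGroup G]

/-- **`U₀^σ = Q_k^{s*}Ṽ` ON THE BONDS MEETING `Ω₁(Z)ᶜ`, FOR ANY RESIDUAL GAUGE.**  [III] (2.2): `Γ₀ = Ω₁ᶜ` is the scale-`0` member of `𝐁_k(Z)` (`Bj_zero`, `0 < k`),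
the scale-`0` constraint is `M⁰(U₀) = U₀ = Ṽ₀ = Q_k^{s*}Ṽ` on `bondsOf Γ₀`, and the root letter [15] (4) («u(y) = 1 for y ∈ 𝔅_k») at scale `0` makes `σ` trivial at both ends of
such a bond; so the gauged minimiser reads the datum there verbatim. [cite: Balaban1988Convergent, (2.2) p.255, (2.11)–(2.13) pp.256–257; Balaban1985Variational, (4) p.278] -/
theorem gaugeAct_apply_eq_qsstarGIter0_of_rootLetter (av : ∀ j, Averaging P j G) (reg : Set (GaugeField P 0 G)) (M₁ : ℕ) (Z : Set (Site P 0))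
    {k : ℕ} (hk0 : 0 < k) (W : GaugeField P k G) {U₀ : GaugeField P 0 G}
    (hmin : IsMinimizer av reg (Bj M₁ Z k) (avgFamily av (qsstarGIter0 k W)) U₀) {σ : GaugeTransf P 0 G}
    (hu : ∀ c ∈ bondsOf (Bj M₁ Z k 0), toMS σ 0 c.src = 1 ∧ toMS σ 0 c.tgt = 1)
    {b : PBond P 0} (hb : b.src ∉ maxDomT M₁ Z 1 ∨ b.tgt ∉ maxDomT M₁ Z 1) :
    gaugeAct σ U₀ b = qsstarGIter0 k W b := by
  have hmem : b ∈ bondsOf (Bj M₁ Z k 0) := by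
    rw [Bj_zero hk0]
    exact hb
  obtain ⟨hs, ht⟩ := hu b hmem
  have hs' : σ b.src = 1 := hs
  have ht' : σ b.tgt = 1 := ht
  have h1 : U₀ b = qsstarGIter0 k W b := hmin.2.1 0 b hmem
  rw [GaugeField.gaugeAct, hs', ht', one_mul, inv_one, mul_one, h1]

/-- ★ **ON A BLOCK-CROSSING BOND MEETING `Ω₁(Z)ᶜ` THE GAUGED MINIMISER IS THE SHADOW VALUE OF THE DATUM FIELD**: `U₀^σ(b) = Ṽ⟨B^k b₋, μ(b)⟩` ([III] (2.16) ∕ [IV] (1.3):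
`Q_k^{s*}Ṽ` is `Ṽ`'s value on the `k`-bond shadow of a corridor bond; `0 < k ≤ m + K`). [cite: Balaban1988Convergent, (2.2) p.255, (2.16) p.257; Balaban1985Variational, (4) p.278] -/
theorem gaugeAct_apply_eq_shadow_of_rootLetter (av : ∀ j, Averaging P j G) (reg : Set (GaugeField P 0 G)) (M₁ : ℕ) (Z : Set (Site P 0))
    {k : ℕ} (hk0 : 0 < k) (hk : k ≤ P.m + P.K) (W : GaugeField P k G) {U₀ : GaugeField P 0 G}
    (hmin : IsMinimizer av reg (Bj M₁ Z k) (avgFamily av (qsstarGIter0 k W)) U₀) {σ : GaugeTransf P 0 G}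
    (hu : ∀ c ∈ bondsOf (Bj M₁ Z k 0), toMS σ 0 c.src = 1 ∧ toMS σ 0 c.tgt = 1)
    {b : PBond P 0} (hb : b.src ∉ maxDomT M₁ Z 1 ∨ b.tgt ∉ maxDomT M₁ Z 1) (hcross : blockIter k b.tgt ≠ blockIter k b.src) :
    gaugeAct σ U₀ b = W ⟨blockIter k b.src, b.dir⟩ := by
  rw [gaugeAct_apply_eq_qsstarGIter0_of_rootLetter av reg M₁ Z hk0 W hmin hu hb, qsstarGIter0_eq k hk W b, if_neg hcross]

/-- **EVERY BOND MEETING `Ω₁(Z)ᶜ` IS AN INPUT BOND OF `𝐁_k(Z)`** (`0 < k`): `bondsOf Γ₀ ⊆ inputs 𝐁_k(Z)` by `feeds 0 c = {c}` — the conjunct «`U₀^σ` near `1` on `inputs 𝐁_k(Z)`»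
therefore quantifies over every fine bond off `Ω₁(Z)`, however far from `Z` (dag-n12-w4's observation `…N12NearFlatChartLetterBookkeeping.norm_sub_one_le_of_plaqNear_of_inputs`,
restated at the level of membership). [cite: Balaban1988Convergent, (2.2) p.255, (2.11) p.256] -/
theorem mem_inputs_of_not_mem (M₁ : ℕ) (Z : Set (Site P 0)) {k : ℕ} (hk0 : 0 < k) {b : PBond P 0}
    (hb : b.src ∉ maxDomT M₁ Z 1 ∨ b.tgt ∉ maxDomT M₁ Z 1) : b ∈ inputs (Bj M₁ Z k) := by
  have hmem : b ∈ bondsOf (Bj M₁ Z k 0) := by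
    rw [Bj_zero hk0]
    exact hb
  exact mem_inputs.2 ⟨0, b, hmem, by rw [feeds_zero]; exact Set.mem_singleton b⟩

end GammaZero

/-! ## §2  With the p. 193 extension as datum: off `Λ^{(k)}` the gauged minimiser reads the RAW base field -/

section Raw

variable {G : Type*} [GaugeGroup G]

/-- ★ **`U₀^σ(b) = V_k⟨B^k b₋, μ(b)⟩` — THE RAW BASE FIELD** when the datum is the p. 193 extension `Ṽ = ext_Λ V_k` (`extend (pts k Λ) g V_k`, any surface gauge `g`; it IS
`V_k` on the bonds of `(Λ^{(k)})ᶜ`, `B15Extension193.extend_eq_of_mem_outBonds`) and the shadow of the block-crossing bond `b` meeting `Ω₁(Z)ᶜ` lies off `Λ^{(k)}`.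
[cite: Balaban1989LargeFieldI, p.193, (1.74) p.192; Balaban1988Convergent, (2.2) p.255, (2.16) p.257] -/
theorem gaugeAct_apply_eq_base_of_rootLetter_of_mem_outBonds (av : ∀ j, Averaging P j G) (reg : Set (GaugeField P 0 G)) (M₁ : ℕ) (Z Λ : Set (Site P 0))
    {k : ℕ} (hk0 : 0 < k) (hk : k ≤ P.m + P.K) (g : GaugeTransf P k G) (Vk : GaugeField P k G) {U₀ : GaugeField P 0 G}
    (hmin : IsMinimizer av reg (Bj M₁ Z k) (avgFamily av (qsstarGIter0 k (extend (pts k Λ) g Vk))) U₀) {σ : GaugeTransf P 0 G}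
    (hu : ∀ c ∈ bondsOf (Bj M₁ Z k 0), toMS σ 0 c.src = 1 ∧ toMS σ 0 c.tgt = 1)
    {b : PBond P 0} (hb : b.src ∉ maxDomT M₁ Z 1 ∨ b.tgt ∉ maxDomT M₁ Z 1) (hcross : blockIter k b.tgt ≠ blockIter k b.src)
    (hout : (⟨blockIter k b.src, b.dir⟩ : PBond P k) ∈ outBonds (pts k Λ)) :
    gaugeAct σ U₀ b = Vk ⟨blockIter k b.src, b.dir⟩ := by
  rw [gaugeAct_apply_eq_shadow_of_rootLetter av reg M₁ Z hk0 hk _ hmin hu hb hcross, extend_eq_of_mem_outBonds g Vk hout]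

end Raw

/-! ## §3  The located necessary condition on the (σ) letter of record -/

section Located

/-- ★★ **THE (σ) LETTER PINS THE RAW BASE FIELD AT EVERY FAR CORRIDOR SHADOW.**  Hypothesis = the CONCLUSION of the endpoint's gauge letter at one base field
`V_k` and one (2.12) minimiser `U₀` of `𝐁_k(Z)` with data `M˙(Q_k^{s*} ext_Λ V_k)`, verbatim: `∃ σ, hu ∧ C1(δc) ∧ Cin(δin)` with `Cin` on `inputs 𝐁_k(Z)`.  Conclusion: at
every `k`-bond `c = ⟨B^k b₋, μ(b)⟩` off `Λ^{(k)}` shadowing a block-crossing bond `b` meeting `Ω₁(Z)ᶜ`, `‖V_k(c) − 1‖ ≤ δin`.  For `c` outside the normalised region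
(outside `Z^{(k)}` whenever `Z ≠ T_ξ`) this is a condition on the RAW base field the guard does not give: the `inputs` conjunct is GLOBAL near-flatness ([III] (2.2)
`Γ₀ = Ω₁ᶜ`), not the localised `hU` of [LF-II] p. 357 ∕ [15] (16)–(18). [cite: Balaban1988Convergent, (2.2) p.255, (2.11)–(2.13) pp.256–257, (2.16) p.257;
Balaban1985Variational, (4) p.278, (16)–(18) p.280; Balaban1989LargeFieldI, (1.74) p.192, p.193, Prop. 1 p.194] -/
theorem norm_base_sub_one_le_of_gaugeLetter (av : ∀ j, Averaging P j SU2) (reg : Set (GaugeField P 0 SU2)) (M₁ : ℕ) (Z Λ : Set (Site P 0))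
    {k : ℕ} (hk0 : 0 < k) (hk : k ≤ P.m + P.K) (g : GaugeTransf P k SU2) (Vk : GaugeField P k SU2) {U₀ : GaugeField P 0 SU2}
    (hmin : IsMinimizer av reg (Bj M₁ Z k) (avgFamily av (qsstarGIter0 k (extend (pts k Λ) g Vk))) U₀) {δin : ℝ}
    {C1 : GaugeField P 0 SU2 → Prop}
    (hσ : ∃ σ : GaugeTransf P 0 SU2,
      (∀ j, j ≤ k → ∀ b ∈ bondsOf (Bj M₁ Z k j), toMS σ j b.src = 1 ∧ toMS σ j b.tgt = 1) ∧ C1 (gaugeAct σ U₀) ∧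
        ∀ b ∈ inputs (Bj M₁ Z k), ‖((gaugeAct σ U₀ b : SU2) : Matrix (Fin 2) (Fin 2) ℂ) - 1‖ ≤ δin)
    {b : PBond P 0} (hb : b.src ∉ maxDomT M₁ Z 1 ∨ b.tgt ∉ maxDomT M₁ Z 1) (hcross : blockIter k b.tgt ≠ blockIter k b.src)
    (hout : (⟨blockIter k b.src, b.dir⟩ : PBond P k) ∈ outBonds (pts k Λ)) :
    ‖((Vk ⟨blockIter k b.src, b.dir⟩ : SU2) : Matrix (Fin 2) (Fin 2) ℂ) - 1‖ ≤ δin := by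
  obtain ⟨σ, hu, -, hCin⟩ := hσ
  rw [← gaugeAct_apply_eq_base_of_rootLetter_of_mem_outBonds av reg M₁ Z Λ hk0 hk g Vk hmin (hu 0 (Nat.zero_le _)) hb hcross hout]
  exact hCin b (mem_inputs_of_not_mem M₁ Z hk0 hb)

/-- ★★ **THE SAME READ OFF THE ENDPOINT's FAMILY BINDER AT ONE BASE FIELD ADMITTING A MINIMISER.**  The family form of (σ) (every guarded base field whose extended datum
is `ρn`-near `1` on the region box, every minimiser) — text of the endpoint with the extension written `ext V = extend (pts k Λ) (g V) V` — applied at ONE guarded,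
box-normalised `V_k` for which a (2.12) minimiser EXISTS ([15] Thm 1, displayed) forces `‖V_k(c) − 1‖ ≤ δin` at every far corridor shadow `c` off `Λ^{(k)}`: the letter is
suppliable only at base fields already `δin`-flat off the region box, i.e. NOT over the guard when such a `c` exists outside the region (`Z ≠ T_ξ`).
[cite: Balaban1989LargeFieldI, (1.74) p.192, p.193, Prop. 1 p.194; Balaban1988Convergent, (2.2) p.255, (2.16) p.257; Balaban1985Variational, Thm 1 p.279, (4) p.278] -/
theorem norm_base_sub_one_le_of_gaugeLetterFamily (av : ∀ j, Averaging P j SU2) (reg : Set (GaugeField P 0 SU2)) (M₁ : ℕ) (Z Λ : Set (Site P 0))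
    {k : ℕ} (hk0 : 0 < k) (hk : k ≤ P.m + P.K) (g : GaugeField P k SU2 → GaugeTransf P k SU2)
    {Guard : GaugeField P k SU2 → Prop} {lo hi : Fin P.d → ℤ} {ρn δin : ℝ} {C1 : GaugeField P 0 SU2 → Prop}
    (hσ : ∀ Vk : GaugeField P k SU2, Guard Vk → (∀ c ∈ (boxBonds lo hi : Set (PBond P k)), dist1 (extend (pts k Λ) (g Vk) Vk c) ≤ ρn) →
      ∀ U₀ : GaugeField P 0 SU2, IsMinimizer av reg (Bj M₁ Z k) (avgFamily av (qsstarGIter0 k (extend (pts k Λ) (g Vk) Vk))) U₀ →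
        ∃ σ : GaugeTransf P 0 SU2,
          (∀ j, j ≤ k → ∀ b ∈ bondsOf (Bj M₁ Z k j), toMS σ j b.src = 1 ∧ toMS σ j b.tgt = 1) ∧ C1 (gaugeAct σ U₀) ∧
            ∀ b ∈ inputs (Bj M₁ Z k), ‖((gaugeAct σ U₀ b : SU2) : Matrix (Fin 2) (Fin 2) ℂ) - 1‖ ≤ δin)
    {Vk : GaugeField P k SU2} (hV : Guard Vk) (hD : ∀ c ∈ (boxBonds lo hi : Set (PBond P k)), dist1 (extend (pts k Λ) (g Vk) Vk c) ≤ ρn)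
    (hex : ∃ U₀ : GaugeField P 0 SU2, IsMinimizer av reg (Bj M₁ Z k) (avgFamily av (qsstarGIter0 k (extend (pts k Λ) (g Vk) Vk))) U₀)
    {b : PBond P 0} (hb : b.src ∉ maxDomT M₁ Z 1 ∨ b.tgt ∉ maxDomT M₁ Z 1) (hcross : blockIter k b.tgt ≠ blockIter k b.src)
    (hout : (⟨blockIter k b.src, b.dir⟩ : PBond P k) ∈ outBonds (pts k Λ)) :
    ‖((Vk ⟨blockIter k b.src, b.dir⟩ : SU2) : Matrix (Fin 2) (Fin 2) ℂ) - 1‖ ≤ δin := by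
  obtain ⟨U₀, hmin⟩ := hex
  exact norm_base_sub_one_le_of_gaugeLetter av reg M₁ Z Λ hk0 hk (g Vk) Vk hmin (hσ Vk hV hD U₀ hmin) hb hcross hout

end Located

/-! ## §4  What the tower-axial gauge does give: the letter with `Cin` localised to a neighbourhood whose `Γ₀`-shadows are normalised -/

section Loc

/-- ★★ **JUNCTION ON A NEIGHBOURHOOD**: for the tower-axial gauge `σ(x) = 𝒰_{U₀}(path x)` of a rooted forest of `𝐁_k(Z)` with the root letter (F2), a (2.12) minimiser `U₀` of
the data generated by `Ṽ`, a set `𝒞` of `k`-bonds on which `Ṽ` is `ρ`-near `1` (`0 ≤ ρ`), a bond set `N` whose block-crossing bonds meeting `Ω₁(Z)ᶜ` have their shadows in `𝒞`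
(geometry), and the DISPLAYED interior letter — [15] (16)–(18) in the gauge `Ax_k(𝔅_k, U₀)`: `dist1 (U₀^σ b) ≤ Θ` on every bond with both ends in `Ω₁(Z)` — every bond of `N` has
`dist1 (U₀^σ b) ≤ max ρ Θ` (pinned half `B15Prop1MinimiserTowerAxialGauge.dist1_gaugeAct_holAtGauge_le_of_shadow` off `Ω₁`, the letter inside).
[cite: Balaban1985Variational, (4) p.278, (16)–(18) p.280; Balaban1985RegularSpaces, (1.19) p.79; Balaban1988Convergent, (2.2) p.255, (2.16) p.257] -/
theorem dist1_gaugeAct_holAtGauge_le_of_mem_nbhd (av : ∀ j, Averaging P j SU2) (reg : Set (GaugeField P 0 SU2)) (M₁ : ℕ) (Z : Set (Site P 0))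
    {k : ℕ} (hk0 : 0 < k) (hk : k ≤ P.m + P.K) (path : Site P 0 → List (LStep P 0))
    (hF2 : ∀ j, j ≤ k → ∀ c ∈ bondsOf (Bj M₁ Z k j), path (embIter j c.src) = [] ∧ path (embIter j c.tgt) = [])
    (W : GaugeField P k SU2) {U₀ : GaugeField P 0 SU2} (hmin : IsMinimizer av reg (Bj M₁ Z k) (avgFamily av (qsstarGIter0 k W)) U₀)
    {ρ Θ : ℝ} (hρ : 0 ≤ ρ) {𝒞 : Set (PBond P k)} (h𝒞 : ∀ c ∈ 𝒞, dist1 (W c) ≤ ρ) {N : Set (PBond P 0)}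
    (hGN : ∀ b ∈ N, (b.src ∉ maxDomT M₁ Z 1 ∨ b.tgt ∉ maxDomT M₁ Z 1) → blockIter k b.tgt ≠ blockIter k b.src →
      (⟨blockIter k b.src, b.dir⟩ : PBond P k) ∈ 𝒞)
    (hL : ∀ b : PBond P 0, b.src ∈ maxDomT M₁ Z 1 → b.tgt ∈ maxDomT M₁ Z 1 → dist1 (gaugeAct (fun x => holAt U₀ (path x)) U₀ b) ≤ Θ)
    {b : PBond P 0} (hb : b ∈ N) :
    dist1 (gaugeAct (fun x => holAt U₀ (path x)) U₀ b) ≤ max ρ Θ := by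
  by_cases h : b.src ∈ maxDomT M₁ Z 1 ∧ b.tgt ∈ maxDomT M₁ Z 1
  · exact (hL b h.1 h.2).trans (le_max_right _ _)
  · have hb' : b.src ∉ maxDomT M₁ Z 1 ∨ b.tgt ∉ maxDomT M₁ Z 1 := by
      by_cases hs : b.src ∈ maxDomT M₁ Z 1
      · exact Or.inr fun ht => h ⟨hs, ht⟩
      · exact Or.inl hs
    exact (dist1_gaugeAct_holAtGauge_le_of_shadow av reg M₁ Z hk0 hk path hF2 W hmin hρ h𝒞 hGN hb hb').trans (le_max_left _ _)

/-- ★★★ **THE LOCALISED GAUGE LETTER (σ) AT THE ENDPOINT's OBJECTS.**  Objects of the lane's endpoint at one instance: averaging `Node00.avOfRecord F 2 Kt`, class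
`regMSCoPOfRecord F 2 ν Kt k (maxDomT ν.M₁ Z)`, determining set `𝐁_k(Z) = Bj ν.M₁ Z k` (`0 < k ≤ m + K`), a base field's extended datum `Ṽ` (`= ext V_k`) which is `ρn`-near `1`
on a set `𝒞` of `k`-bonds — the region box `boxBonds LO HI` of the endpoint of record, or a general region (dag-n12-c LOCATED-GEOM) — (`0 ≤ ρn`), a (2.12) minimiser `U₀`; a rooted
forest `path` with (F1)(F2) at `𝐁_k(Z)` (dag-n12-w3's hierarchical comb ∕ `N12RootedForest`); a bond neighbourhood `N` whose block-crossing bonds meeting `Ω₁(Z)ᶜ` have their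
`k`-shadows in `𝒞` and which contains the four bonds of every plaquette touching `Ω₁(Z)` (geometry letters); and the DISPLAYED interior letter [15] (16)–(18) for `U₀` in the gauge
`Ax_k(𝔅_k, U₀)` with bound `Θ`.  THEN the tower-axial gauge `σ` carries: the root
letter `hu` at all levels `≤ k`; (C1) VERBATIM — the four bonds of every plaquette touching `Ω₁(Z)` are `max ρn Θ`-near `1`; and (Cin) ON `inputs 𝐁_k(Z) ∩ N` with the same
tolerance.  The global `inputs` conjunct of the endpoint of record is NOT produced (§3). [cite: Balaban1985Variational, (4) p.278, (16)–(18) p.280; Balaban1985RegularSpaces, (1.19) p.79;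
Balaban1988Convergent, (2.2) p.255, (2.11)–(2.13) pp.256–257, (2.16) p.257; Balaban1989LargeFieldI, (1.74) p.192, Prop. 1 p.194] -/
theorem exists_gaugeLetterLoc_atRecord {F : T4Family} (ν : Node00.Stage7Numerics) (Kt : ℕ) {k : ℕ} (hk0 : 0 < k)
    (hk : k ≤ (F.P Kt).m + (F.P Kt).K) (Z : Set (Site (F.P Kt) 0))
    (path : Site (F.P Kt) 0 → List (LStep (F.P Kt) 0))
    (hF2 : ∀ j, j ≤ k → ∀ c ∈ bondsOf (Bj ν.M₁ Z k j), path (embIter j c.src) = [] ∧ path (embIter j c.tgt) = [])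
    {ρn Θ : ℝ} (hρn : 0 ≤ ρn)
    (W : GaugeField (F.P Kt) k SU2) (𝒞 : Set (PBond (F.P Kt) k)) (hD : ∀ c ∈ 𝒞, dist1 (W c) ≤ ρn)
    {U₀ : GaugeField (F.P Kt) 0 SU2}
    (hmin : IsMinimizer (Node00.avOfRecord F 2 Kt) (Node00.regMSCoPOfRecord F 2 ν Kt k (maxDomT ν.M₁ Z)) (Bj ν.M₁ Z k)
      (avgFamily (Node00.avOfRecord F 2 Kt) (qsstarGIter0 k W)) U₀)
    -- geometry of the neighbourhood `N`
    (N : Set (PBond (F.P Kt) 0))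
    (hGN : ∀ b ∈ N, (b.src ∉ maxDomT ν.M₁ Z 1 ∨ b.tgt ∉ maxDomT ν.M₁ Z 1) → blockIter k b.tgt ≠ blockIter k b.src →
      (⟨blockIter k b.src, b.dir⟩ : PBond (F.P Kt) k) ∈ 𝒞)
    (hN1 : ∀ p : Plaq (F.P Kt) 0, ((⟨p.src, p.μ⟩ : PBond (F.P Kt) 0) ∈ {b : PBond (F.P Kt) 0 | b.src ∈ maxDomT ν.M₁ Z 1} ∨
        (⟨p.src.shift p.μ, p.ν⟩ : PBond (F.P Kt) 0) ∈ {b : PBond (F.P Kt) 0 | b.src ∈ maxDomT ν.M₁ Z 1} ∨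
        (⟨p.src.shift p.ν, p.μ⟩ : PBond (F.P Kt) 0) ∈ {b : PBond (F.P Kt) 0 | b.src ∈ maxDomT ν.M₁ Z 1} ∨
        (⟨p.src, p.ν⟩ : PBond (F.P Kt) 0) ∈ {b : PBond (F.P Kt) 0 | b.src ∈ maxDomT ν.M₁ Z 1}) →
      (⟨p.src, p.μ⟩ : PBond (F.P Kt) 0) ∈ N ∧ (⟨p.src.shift p.μ, p.ν⟩ : PBond (F.P Kt) 0) ∈ N ∧
        (⟨p.src.shift p.ν, p.μ⟩ : PBond (F.P Kt) 0) ∈ N ∧ (⟨p.src, p.ν⟩ : PBond (F.P Kt) 0) ∈ N)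
    -- DISPLAYED: the interior estimate [15] (16)–(18) in the tower-axial gauge, on the bonds inside `Ω₁(Z)`
    (hL : ∀ b : PBond (F.P Kt) 0, b.src ∈ maxDomT ν.M₁ Z 1 → b.tgt ∈ maxDomT ν.M₁ Z 1 →
      ‖((gaugeAct (fun x => holAt U₀ (path x)) U₀ b : SU2) : Matrix (Fin 2) (Fin 2) ℂ) - 1‖ ≤ Θ) :
    ∃ σ : GaugeTransf (F.P Kt) 0 SU2,
      (∀ j, j ≤ k → ∀ b ∈ bondsOf (Bj ν.M₁ Z k j), toMS σ j b.src = 1 ∧ toMS σ j b.tgt = 1) ∧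
        (∀ p : Plaq (F.P Kt) 0, ((⟨p.src, p.μ⟩ : PBond (F.P Kt) 0) ∈ {b : PBond (F.P Kt) 0 | b.src ∈ maxDomT ν.M₁ Z 1} ∨
            (⟨p.src.shift p.μ, p.ν⟩ : PBond (F.P Kt) 0) ∈ {b : PBond (F.P Kt) 0 | b.src ∈ maxDomT ν.M₁ Z 1} ∨
            (⟨p.src.shift p.ν, p.μ⟩ : PBond (F.P Kt) 0) ∈ {b : PBond (F.P Kt) 0 | b.src ∈ maxDomT ν.M₁ Z 1} ∨
            (⟨p.src, p.ν⟩ : PBond (F.P Kt) 0) ∈ {b : PBond (F.P Kt) 0 | b.src ∈ maxDomT ν.M₁ Z 1}) →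
          ‖((gaugeAct σ U₀ ⟨p.src, p.μ⟩ : SU2) : Matrix (Fin 2) (Fin 2) ℂ) - 1‖ ≤ max ρn Θ ∧
            ‖((gaugeAct σ U₀ ⟨p.src.shift p.μ, p.ν⟩ : SU2) : Matrix (Fin 2) (Fin 2) ℂ) - 1‖ ≤ max ρn Θ ∧
            ‖((gaugeAct σ U₀ ⟨p.src.shift p.ν, p.μ⟩ : SU2) : Matrix (Fin 2) (Fin 2) ℂ) - 1‖ ≤ max ρn Θ ∧
            ‖((gaugeAct σ U₀ ⟨p.src, p.ν⟩ : SU2) : Matrix (Fin 2) (Fin 2) ℂ) - 1‖ ≤ max ρn Θ) ∧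
        (∀ b ∈ inputs (Bj ν.M₁ Z k), b ∈ N → ‖((gaugeAct σ U₀ b : SU2) : Matrix (Fin 2) (Fin 2) ℂ) - 1‖ ≤ max ρn Θ) := by
  have key : ∀ b ∈ N, dist1 (gaugeAct (fun x => holAt U₀ (path x)) U₀ b) ≤ max ρn Θ := fun b hb =>
    dist1_gaugeAct_holAtGauge_le_of_mem_nbhd (Node00.avOfRecord F 2 Kt) _ ν.M₁ Z hk0 hk path hF2 W hmin hρn hD hGN hL hb
  refine ⟨fun x => holAt U₀ (path x), toMS_holAtGauge_eq_one path U₀ (Bj ν.M₁ Z k) k hF2, fun p hp => ?_, fun b _ hbN => key b hbN⟩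
  obtain ⟨h₁, h₂, h₃, h₄⟩ := hN1 p hp
  exact ⟨key _ h₁, key _ h₂, key _ h₃, key _ h₄⟩

end Loc

/-! ## §5  Linear moduli: the tolerances of the localised letter are linear in the guard -/

section Linear

/-- ★★★ **THE LOCALISED GAUGE LETTER WITH TOLERANCES LINEAR IN THE GUARD.**  §4 with the datum tolerance bounded by the normaliser's wander bound `ρn ≤ Cρ·eR`
(`B15Prop1DatumGaugeNormalisation` §2∕§7: `ρn` is a polynomial of the region box times the plaquette bound `eR`) and the interior bound by `Θ ≤ CΘ·eR` (the (q2) Stokes ∕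
corridor bounds `T4ForestGaugeSameRootBound` ∕ `T4ForestGaugeCorridorBound` on `eR`-small plaquettes, [15] Thm 1 (8); `0 ≤ CΘ`, `0 ≤ ρn`, `0 < eR`): BOTH tolerances of the letter
are `(Cρ + CΘ)·eR` — the linear moduli the numerics road consumes (the knit chooses `eR` last, `B15Prop1NumericsThresholds.exists_eR_of_linear_moduli`).
[cite: Balaban1989LargeFieldI, Prop. 1 p.194 («for ε > 0 sufficiently small»); Balaban1985Variational, (4) p.278, Thm 1 (8) p.279, (16)–(18) p.280; Balaban1988Convergent, (2.2) p.255, (2.16) p.257] -/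
theorem exists_gaugeLetterLoc_linear_atRecord {F : T4Family} (ν : Node00.Stage7Numerics) (Kt : ℕ) {k : ℕ} (hk0 : 0 < k)
    (hk : k ≤ (F.P Kt).m + (F.P Kt).K) (Z : Set (Site (F.P Kt) 0))
    (path : Site (F.P Kt) 0 → List (LStep (F.P Kt) 0))
    (hF2 : ∀ j, j ≤ k → ∀ c ∈ bondsOf (Bj ν.M₁ Z k j), path (embIter j c.src) = [] ∧ path (embIter j c.tgt) = [])
    {ρn Θ eR Cρ CΘ : ℝ} (hρn : 0 ≤ ρn) (heR : 0 < eR) (hCΘ : 0 ≤ CΘ)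
    (hρle : ρn ≤ Cρ * eR) (hΘle : Θ ≤ CΘ * eR)
    (W : GaugeField (F.P Kt) k SU2) (𝒞 : Set (PBond (F.P Kt) k)) (hD : ∀ c ∈ 𝒞, dist1 (W c) ≤ ρn)
    {U₀ : GaugeField (F.P Kt) 0 SU2}
    (hmin : IsMinimizer (Node00.avOfRecord F 2 Kt) (Node00.regMSCoPOfRecord F 2 ν Kt k (maxDomT ν.M₁ Z)) (Bj ν.M₁ Z k)
      (avgFamily (Node00.avOfRecord F 2 Kt) (qsstarGIter0 k W)) U₀)
    (N : Set (PBond (F.P Kt) 0))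
    (hGN : ∀ b ∈ N, (b.src ∉ maxDomT ν.M₁ Z 1 ∨ b.tgt ∉ maxDomT ν.M₁ Z 1) → blockIter k b.tgt ≠ blockIter k b.src →
      (⟨blockIter k b.src, b.dir⟩ : PBond (F.P Kt) k) ∈ 𝒞)
    (hN1 : ∀ p : Plaq (F.P Kt) 0, ((⟨p.src, p.μ⟩ : PBond (F.P Kt) 0) ∈ {b : PBond (F.P Kt) 0 | b.src ∈ maxDomT ν.M₁ Z 1} ∨
        (⟨p.src.shift p.μ, p.ν⟩ : PBond (F.P Kt) 0) ∈ {b : PBond (F.P Kt) 0 | b.src ∈ maxDomT ν.M₁ Z 1} ∨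
        (⟨p.src.shift p.ν, p.μ⟩ : PBond (F.P Kt) 0) ∈ {b : PBond (F.P Kt) 0 | b.src ∈ maxDomT ν.M₁ Z 1} ∨
        (⟨p.src, p.ν⟩ : PBond (F.P Kt) 0) ∈ {b : PBond (F.P Kt) 0 | b.src ∈ maxDomT ν.M₁ Z 1}) →
      (⟨p.src, p.μ⟩ : PBond (F.P Kt) 0) ∈ N ∧ (⟨p.src.shift p.μ, p.ν⟩ : PBond (F.P Kt) 0) ∈ N ∧
        (⟨p.src.shift p.ν, p.μ⟩ : PBond (F.P Kt) 0) ∈ N ∧ (⟨p.src, p.ν⟩ : PBond (F.P Kt) 0) ∈ N)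
    (hL : ∀ b : PBond (F.P Kt) 0, b.src ∈ maxDomT ν.M₁ Z 1 → b.tgt ∈ maxDomT ν.M₁ Z 1 →
      ‖((gaugeAct (fun x => holAt U₀ (path x)) U₀ b : SU2) : Matrix (Fin 2) (Fin 2) ℂ) - 1‖ ≤ Θ) :
    ∃ σ : GaugeTransf (F.P Kt) 0 SU2,
      (∀ j, j ≤ k → ∀ b ∈ bondsOf (Bj ν.M₁ Z k j), toMS σ j b.src = 1 ∧ toMS σ j b.tgt = 1) ∧
        (∀ p : Plaq (F.P Kt) 0, ((⟨p.src, p.μ⟩ : PBond (F.P Kt) 0) ∈ {b : PBond (F.P Kt) 0 | b.src ∈ maxDomT ν.M₁ Z 1} ∨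
            (⟨p.src.shift p.μ, p.ν⟩ : PBond (F.P Kt) 0) ∈ {b : PBond (F.P Kt) 0 | b.src ∈ maxDomT ν.M₁ Z 1} ∨
            (⟨p.src.shift p.ν, p.μ⟩ : PBond (F.P Kt) 0) ∈ {b : PBond (F.P Kt) 0 | b.src ∈ maxDomT ν.M₁ Z 1} ∨
            (⟨p.src, p.ν⟩ : PBond (F.P Kt) 0) ∈ {b : PBond (F.P Kt) 0 | b.src ∈ maxDomT ν.M₁ Z 1}) →
          ‖((gaugeAct σ U₀ ⟨p.src, p.μ⟩ : SU2) : Matrix (Fin 2) (Fin 2) ℂ) - 1‖ ≤ (Cρ + CΘ) * eR ∧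
            ‖((gaugeAct σ U₀ ⟨p.src.shift p.μ, p.ν⟩ : SU2) : Matrix (Fin 2) (Fin 2) ℂ) - 1‖ ≤ (Cρ + CΘ) * eR ∧
            ‖((gaugeAct σ U₀ ⟨p.src.shift p.ν, p.μ⟩ : SU2) : Matrix (Fin 2) (Fin 2) ℂ) - 1‖ ≤ (Cρ + CΘ) * eR ∧
            ‖((gaugeAct σ U₀ ⟨p.src, p.ν⟩ : SU2) : Matrix (Fin 2) (Fin 2) ℂ) - 1‖ ≤ (Cρ + CΘ) * eR) ∧
        (∀ b ∈ inputs (Bj ν.M₁ Z k), b ∈ N → ‖((gaugeAct σ U₀ b : SU2) : Matrix (Fin 2) (Fin 2) ℂ) - 1‖ ≤ (Cρ + CΘ) * eR) := by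
  have hΘ0 : max ρn Θ ≤ (Cρ + CΘ) * eR := by
    have h1 : 0 ≤ CΘ * eR := mul_nonneg hCΘ heR.le
    have h2 : 0 ≤ Cρ * eR := hρn.trans hρle
    refine max_le ?_ ?_ <;> nlinarith
  obtain ⟨σ, hu, hC1, hCin⟩ := exists_gaugeLetterLoc_atRecord ν Kt hk0 hk Z path hF2 hρn W 𝒞 hD hmin N hGN hN1 hL
  refine ⟨σ, hu, fun p hp => ?_, fun b hb hbN => (hCin b hb hbN).trans hΘ0⟩
  obtain ⟨h₁, h₂, h₃, h₄⟩ := hC1 p hp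
  exact ⟨h₁.trans hΘ0, h₂.trans hΘ0, h₃.trans hΘ0, h₄.trans hΘ0⟩

/-- ★★ **ANY TARGET TOLERANCE IS MET BELOW A GUARD** (the `∀δ∃e` reading the knit uses: choose the target `δT`, then `eR` with `(Cρ + CΘ)·eR ≤ δT`,
e.g. by `B15Prop1NumericsThresholds.exists_eR_of_linear_moduli`): the localised letter of §4 holds with both tolerances `δT`.
[cite: Balaban1989LargeFieldI, Prop. 1 p.194 («for ε > 0 sufficiently small»); Balaban1985Variational, (4) p.278, (16)–(18) p.280; Balaban1988Convergent, (2.2) p.255, (2.16) p.257] -/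
theorem exists_gaugeLetterLoc_of_target_atRecord {F : T4Family} (ν : Node00.Stage7Numerics) (Kt : ℕ) {k : ℕ} (hk0 : 0 < k)
    (hk : k ≤ (F.P Kt).m + (F.P Kt).K) (Z : Set (Site (F.P Kt) 0))
    (path : Site (F.P Kt) 0 → List (LStep (F.P Kt) 0))
    (hF2 : ∀ j, j ≤ k → ∀ c ∈ bondsOf (Bj ν.M₁ Z k j), path (embIter j c.src) = [] ∧ path (embIter j c.tgt) = [])
    {ρn Θ eR Cρ CΘ δT : ℝ} (hρn : 0 ≤ ρn) (heR : 0 < eR) (hCΘ : 0 ≤ CΘ)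
    (hρle : ρn ≤ Cρ * eR) (hΘle : Θ ≤ CΘ * eR) (hT : (Cρ + CΘ) * eR ≤ δT)
    (W : GaugeField (F.P Kt) k SU2) (𝒞 : Set (PBond (F.P Kt) k)) (hD : ∀ c ∈ 𝒞, dist1 (W c) ≤ ρn)
    {U₀ : GaugeField (F.P Kt) 0 SU2}
    (hmin : IsMinimizer (Node00.avOfRecord F 2 Kt) (Node00.regMSCoPOfRecord F 2 ν Kt k (maxDomT ν.M₁ Z)) (Bj ν.M₁ Z k)
      (avgFamily (Node00.avOfRecord F 2 Kt) (qsstarGIter0 k W)) U₀)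
    (N : Set (PBond (F.P Kt) 0))
    (hGN : ∀ b ∈ N, (b.src ∉ maxDomT ν.M₁ Z 1 ∨ b.tgt ∉ maxDomT ν.M₁ Z 1) → blockIter k b.tgt ≠ blockIter k b.src →
      (⟨blockIter k b.src, b.dir⟩ : PBond (F.P Kt) k) ∈ 𝒞)
    (hN1 : ∀ p : Plaq (F.P Kt) 0, ((⟨p.src, p.μ⟩ : PBond (F.P Kt) 0) ∈ {b : PBond (F.P Kt) 0 | b.src ∈ maxDomT ν.M₁ Z 1} ∨
        (⟨p.src.shift p.μ, p.ν⟩ : PBond (F.P Kt) 0) ∈ {b : PBond (F.P Kt) 0 | b.src ∈ maxDomT ν.M₁ Z 1} ∨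
        (⟨p.src.shift p.ν, p.μ⟩ : PBond (F.P Kt) 0) ∈ {b : PBond (F.P Kt) 0 | b.src ∈ maxDomT ν.M₁ Z 1} ∨
        (⟨p.src, p.ν⟩ : PBond (F.P Kt) 0) ∈ {b : PBond (F.P Kt) 0 | b.src ∈ maxDomT ν.M₁ Z 1}) →
      (⟨p.src, p.μ⟩ : PBond (F.P Kt) 0) ∈ N ∧ (⟨p.src.shift p.μ, p.ν⟩ : PBond (F.P Kt) 0) ∈ N ∧
        (⟨p.src.shift p.ν, p.μ⟩ : PBond (F.P Kt) 0) ∈ N ∧ (⟨p.src, p.ν⟩ : PBond (F.P Kt) 0) ∈ N)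
    (hL : ∀ b : PBond (F.P Kt) 0, b.src ∈ maxDomT ν.M₁ Z 1 → b.tgt ∈ maxDomT ν.M₁ Z 1 →
      ‖((gaugeAct (fun x => holAt U₀ (path x)) U₀ b : SU2) : Matrix (Fin 2) (Fin 2) ℂ) - 1‖ ≤ Θ) :
    ∃ σ : GaugeTransf (F.P Kt) 0 SU2,
      (∀ j, j ≤ k → ∀ b ∈ bondsOf (Bj ν.M₁ Z k j), toMS σ j b.src = 1 ∧ toMS σ j b.tgt = 1) ∧
        (∀ p : Plaq (F.P Kt) 0, ((⟨p.src, p.μ⟩ : PBond (F.P Kt) 0) ∈ {b : PBond (F.P Kt) 0 | b.src ∈ maxDomT ν.M₁ Z 1} ∨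
            (⟨p.src.shift p.μ, p.ν⟩ : PBond (F.P Kt) 0) ∈ {b : PBond (F.P Kt) 0 | b.src ∈ maxDomT ν.M₁ Z 1} ∨
            (⟨p.src.shift p.ν, p.μ⟩ : PBond (F.P Kt) 0) ∈ {b : PBond (F.P Kt) 0 | b.src ∈ maxDomT ν.M₁ Z 1} ∨
            (⟨p.src, p.ν⟩ : PBond (F.P Kt) 0) ∈ {b : PBond (F.P Kt) 0 | b.src ∈ maxDomT ν.M₁ Z 1}) →
          ‖((gaugeAct σ U₀ ⟨p.src, p.μ⟩ : SU2) : Matrix (Fin 2) (Fin 2) ℂ) - 1‖ ≤ δT ∧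
            ‖((gaugeAct σ U₀ ⟨p.src.shift p.μ, p.ν⟩ : SU2) : Matrix (Fin 2) (Fin 2) ℂ) - 1‖ ≤ δT ∧
            ‖((gaugeAct σ U₀ ⟨p.src.shift p.ν, p.μ⟩ : SU2) : Matrix (Fin 2) (Fin 2) ℂ) - 1‖ ≤ δT ∧
            ‖((gaugeAct σ U₀ ⟨p.src, p.ν⟩ : SU2) : Matrix (Fin 2) (Fin 2) ℂ) - 1‖ ≤ δT) ∧
        (∀ b ∈ inputs (Bj ν.M₁ Z k), b ∈ N → ‖((gaugeAct σ U₀ b : SU2) : Matrix (Fin 2) (Fin 2) ℂ) - 1‖ ≤ δT) := by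
  obtain ⟨σ, hu, hC1, hCin⟩ :=
    exists_gaugeLetterLoc_linear_atRecord ν Kt hk0 hk Z path hF2 hρn heR hCΘ hρle hΘle W 𝒞 hD hmin N hGN hN1 hL
  refine ⟨σ, hu, fun p hp => ?_, fun b hb hbN => (hCin b hb hbN).trans hT⟩
  obtain ⟨h₁, h₂, h₃, h₄⟩ := hC1 p hp
  exact ⟨h₁.trans hT, h₂.trans hT, h₃.trans hT, h₄.trans hT⟩

/-- ★★ **THE SAME AT THE ENDPOINT's REGION BOX** (`𝒞 := boxBonds LO HI`, the datum hypothesis of the (σ) text of record verbatim: `∀ c ∈ boxBonds LO HI, dist1 (Ṽ c) ≤ ρn`):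
the localised gauge letter with both tolerances any target `δT ≥ (Cρ + CΘ)·eR`. [cite: Balaban1989LargeFieldI, Prop. 1 p.194; Balaban1985Variational, (4) p.278, (16)–(18) p.280; Balaban1988Convergent, (2.2) p.255, (2.16) p.257] -/
theorem exists_gaugeLetterLoc_of_target_atRecord_box {F : T4Family} (ν : Node00.Stage7Numerics) (Kt : ℕ) {k : ℕ} (hk0 : 0 < k)
    (hk : k ≤ (F.P Kt).m + (F.P Kt).K) (Z : Set (Site (F.P Kt) 0))
    (path : Site (F.P Kt) 0 → List (LStep (F.P Kt) 0))
    (hF2 : ∀ j, j ≤ k → ∀ c ∈ bondsOf (Bj ν.M₁ Z k j), path (embIter j c.src) = [] ∧ path (embIter j c.tgt) = [])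
    {LO HI : Fin (F.P Kt).d → ℤ} {ρn Θ eR Cρ CΘ δT : ℝ} (hρn : 0 ≤ ρn) (heR : 0 < eR) (hCΘ : 0 ≤ CΘ)
    (hρle : ρn ≤ Cρ * eR) (hΘle : Θ ≤ CΘ * eR) (hT : (Cρ + CΘ) * eR ≤ δT)
    (W : GaugeField (F.P Kt) k SU2) (hD : ∀ c ∈ (boxBonds LO HI : Set (PBond (F.P Kt) k)), dist1 (W c) ≤ ρn)
    {U₀ : GaugeField (F.P Kt) 0 SU2}
    (hmin : IsMinimizer (Node00.avOfRecord F 2 Kt) (Node00.regMSCoPOfRecord F 2 ν Kt k (maxDomT ν.M₁ Z)) (Bj ν.M₁ Z k)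
      (avgFamily (Node00.avOfRecord F 2 Kt) (qsstarGIter0 k W)) U₀)
    (N : Set (PBond (F.P Kt) 0))
    (hGN : ∀ b ∈ N, (b.src ∉ maxDomT ν.M₁ Z 1 ∨ b.tgt ∉ maxDomT ν.M₁ Z 1) → blockIter k b.tgt ≠ blockIter k b.src →
      (⟨blockIter k b.src, b.dir⟩ : PBond (F.P Kt) k) ∈ (boxBonds LO HI : Set (PBond (F.P Kt) k)))
    (hN1 : ∀ p : Plaq (F.P Kt) 0, ((⟨p.src, p.μ⟩ : PBond (F.P Kt) 0) ∈ {b : PBond (F.P Kt) 0 | b.src ∈ maxDomT ν.M₁ Z 1} ∨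
        (⟨p.src.shift p.μ, p.ν⟩ : PBond (F.P Kt) 0) ∈ {b : PBond (F.P Kt) 0 | b.src ∈ maxDomT ν.M₁ Z 1} ∨
        (⟨p.src.shift p.ν, p.μ⟩ : PBond (F.P Kt) 0) ∈ {b : PBond (F.P Kt) 0 | b.src ∈ maxDomT ν.M₁ Z 1} ∨
        (⟨p.src, p.ν⟩ : PBond (F.P Kt) 0) ∈ {b : PBond (F.P Kt) 0 | b.src ∈ maxDomT ν.M₁ Z 1}) →
      (⟨p.src, p.μ⟩ : PBond (F.P Kt) 0) ∈ N ∧ (⟨p.src.shift p.μ, p.ν⟩ : PBond (F.P Kt) 0) ∈ N ∧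
        (⟨p.src.shift p.ν, p.μ⟩ : PBond (F.P Kt) 0) ∈ N ∧ (⟨p.src, p.ν⟩ : PBond (F.P Kt) 0) ∈ N)
    (hL : ∀ b : PBond (F.P Kt) 0, b.src ∈ maxDomT ν.M₁ Z 1 → b.tgt ∈ maxDomT ν.M₁ Z 1 →
      ‖((gaugeAct (fun x => holAt U₀ (path x)) U₀ b : SU2) : Matrix (Fin 2) (Fin 2) ℂ) - 1‖ ≤ Θ) :
    ∃ σ : GaugeTransf (F.P Kt) 0 SU2,
      (∀ j, j ≤ k → ∀ b ∈ bondsOf (Bj ν.M₁ Z k j), toMS σ j b.src = 1 ∧ toMS σ j b.tgt = 1) ∧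
        (∀ p : Plaq (F.P Kt) 0, ((⟨p.src, p.μ⟩ : PBond (F.P Kt) 0) ∈ {b : PBond (F.P Kt) 0 | b.src ∈ maxDomT ν.M₁ Z 1} ∨
            (⟨p.src.shift p.μ, p.ν⟩ : PBond (F.P Kt) 0) ∈ {b : PBond (F.P Kt) 0 | b.src ∈ maxDomT ν.M₁ Z 1} ∨
            (⟨p.src.shift p.ν, p.μ⟩ : PBond (F.P Kt) 0) ∈ {b : PBond (F.P Kt) 0 | b.src ∈ maxDomT ν.M₁ Z 1} ∨
            (⟨p.src, p.ν⟩ : PBond (F.P Kt) 0) ∈ {b : PBond (F.P Kt) 0 | b.src ∈ maxDomT ν.M₁ Z 1}) →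
          ‖((gaugeAct σ U₀ ⟨p.src, p.μ⟩ : SU2) : Matrix (Fin 2) (Fin 2) ℂ) - 1‖ ≤ δT ∧
            ‖((gaugeAct σ U₀ ⟨p.src.shift p.μ, p.ν⟩ : SU2) : Matrix (Fin 2) (Fin 2) ℂ) - 1‖ ≤ δT ∧
            ‖((gaugeAct σ U₀ ⟨p.src.shift p.ν, p.μ⟩ : SU2) : Matrix (Fin 2) (Fin 2) ℂ) - 1‖ ≤ δT ∧
            ‖((gaugeAct σ U₀ ⟨p.src, p.ν⟩ : SU2) : Matrix (Fin 2) (Fin 2) ℂ) - 1‖ ≤ δT) ∧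
        (∀ b ∈ inputs (Bj ν.M₁ Z k), b ∈ N → ‖((gaugeAct σ U₀ b : SU2) : Matrix (Fin 2) (Fin 2) ℂ) - 1‖ ≤ δT) :=
  exists_gaugeLetterLoc_of_target_atRecord ν Kt hk0 hk Z path hF2 hρn heR hCΘ hρle hΘle hT W (boxBonds LO HI) hD hmin N hGN hN1 hL

end Linear

end Literature.MathematicalPhysics.QuantumFieldTheory.Balaban1983to89.B15Prop1GaugeLetterGammaZeroPin

end
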